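import Mathlib.Data.Nat.Log
import Mathlib.Data.Nat.Sqrt
import Mathlib.Analysis.SpecialFunctions.Pow.Real
import Literature.Algebra.EuclideanLattices.KhotAssembly
import Literature.Algebra.EuclideanLattices.KhotCardinality
import Literature.InformationTheory.Coding.BCHIndependence
import HarnessLib

/-!
# Khot 2005, Thm. 1.1 (constant factors, `p = 2`), mathematical form: the explicit parameter choice and the final gap-instance theorem

Topic `Algebra/EuclideanLattices`, namespace `Literature.Algebra.EuclideanLattices.Khot` (sub-namespace
`Params` for the explicit parameters). Last mathematical brick of the decomposition of
`Literature.Algebra.EuclideanLattices.gapSVP_const_isNPHardRandomized` (pqc.S17) through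
`Khot2005_SAT_randReducible_gapSVP` (`KhotSVPHardness.lean`): it DISCHARGES the abstract numeric side
conditions of `KhotAssembly.card_bad_yes_total_le` / `card_bad_no_total_le` by an explicit choice of
all parameters as functions of the set-system sizes `u = |U|`, `σ = |S|`, the cover size `K` and the
number of levels `k` (which depends only on the target factor `γ₀`), and proves the mathematical
form of Khot's Theorem 1.1 for the Euclidean norm (`khot_gap_instances`): for every `γ₀ ≥ 1` there is
`k` such that for every set system, outside at most a `2/100` fraction of the random choices
(tuple of columns, row vector), Khot's instance is a YES instance of `GapSVP_{γ₀}` if the system has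
an exact cover by `K` sets, and a NO instance if no `< 40K` sets cover the universe (the two sides of
`gapSetCover 40`, `GapSetCover.lean`, in Khot's form, Thm. 3.1).

## The parameter choice (`p = 2`, `η = 1/40`, §7.3 "choosing `k` to be a large enough constant")

`d = 40K`, `r = 31K`, `g₀ = 35K` (`γ = 7/8`), BCH `t = 20K` over `GF(2^m)` with `m = M + 1`,
`N = 2^M` columns, `h = 20K(M+1)` rows, `M = 2M'` with
`M' = (log₂A+1)/(K+1) + 1 + (16·(5(k+1))² + 16) + (log₂(200·(31K)²) + 1)` (`A` an explicit
polynomial-size quantity), coefficient bound `s = K + 31K + h(31K)² + 1 + (35K)²`, `W = sᵏ`,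
`D = Q = T = sᵏ(40K)^{k+1}`, `q = 100·#A_bound·D` with the sparse-vector bound of Lemma 5.5,
`B' = 100·q·(31K)^{31K}`, threshold `τ = ⌊√(2W²g₀^{k+1})⌋ + 1`, `k` with `(8/7)^k > 8γ₀²`. The size
`N = 2^{2M'}` is polynomial in `u, σ, K` for fixed `k` (all exponents of `M'` are `O(k)`); this is
where the "polynomial-time" of §7.3 will come from at the machine level (not in this file).
The elementary growth estimate used is `(M+1)^{2E} ≤ 2^M` for `M ≥ 16E² + 16`.

## What this leaves

The machine level (`RandAlg.IsPolyTime` of the explicit map, sampling from coins), the glue from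
`(SAT, UNSAT)` to `ofLanguage SAT`, and the PCP-based named fact `AroraEtAl1997_prop6`.

## References

* S. Khot, *Hardness of approximating the shortest vector problem in lattices*, J. ACM 52 (2005)
  789–808, Thm. 1.1, Thm. 3.1, Thm. 5.1, §7.3.
-/

noncomputable section

namespace Literature.Algebra.EuclideanLattices.Khot

open Matrix Finset


/-- `(a+1)^E · a ≤ a^E · (a + 2E)` for `a ≥ 2E` (i.e. `(1 + 1/a)^E ≤ 1 + 2E/a`). [folklore] -/
theorem succ_pow_mul_le (a : ℕ) : ∀ E : ℕ, 2 * E ≤ a → (a + 1) ^ E * a ≤ a ^ E * (a + 2 * E)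
  | 0, _ => by simp
  | E + 1, h => by
    have ih := succ_pow_mul_le a E (by omega)
    have h1 : (a + 1) ^ (E + 1) * a = (a + 1) * ((a + 1) ^ E * a) := by ring
    rw [h1]
    calc (a + 1) * ((a + 1) ^ E * a) ≤ (a + 1) * (a ^ E * (a + 2 * E)) := Nat.mul_le_mul_left _ ih
      _ = a ^ E * (a * a + 2 * E * a + a + 2 * E) := by ring
      _ ≤ a ^ E * (a * a + 2 * E * a + a + a) := Nat.mul_le_mul_left _ (by omega)
      _ = a ^ (E + 1) * (a + 2 * (E + 1)) := by ring

/-- `(a+1)^E ≤ 2·a^E` for `a ≥ 2E`, `a ≥ 1`. [folklore] -/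
theorem succ_pow_le_two_mul_pow {a E : ℕ} (h : 2 * E ≤ a) (ha : 1 ≤ a) : (a + 1) ^ E ≤ 2 * a ^ E := by
  have h1 := succ_pow_mul_le a E h
  have h2 : a ^ E * (a + 2 * E) ≤ a ^ E * (2 * a) := Nat.mul_le_mul_left _ (by omega)
  have h3 : (a + 1) ^ E * a ≤ (2 * a ^ E) * a := by
    calc (a + 1) ^ E * a ≤ a ^ E * (2 * a) := h1.trans h2
      _ = (2 * a ^ E) * a := by ring
  exact Nat.le_of_mul_le_mul_right h3 ha

/-- `n² ≤ 4^n`. [folklore] -/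
theorem sq_le_four_pow : ∀ n : ℕ, n ^ 2 ≤ 4 ^ n
  | 0 => by norm_num
  | n + 1 => by
    have ih := sq_le_four_pow n
    have : (n + 1) ^ 2 ≤ 2 * n ^ 2 + 2 := by nlinarith
    have h4 : 1 ≤ 4 ^ n := Nat.one_le_pow _ _ (by norm_num)
    calc (n + 1) ^ 2 ≤ 2 * n ^ 2 + 2 := this
      _ ≤ 2 * 4 ^ n + 2 * 4 ^ n := Nat.add_le_add (Nat.mul_le_mul_left 2 ih) (by linarith)
      _ = 4 ^ (n + 1) := by rw [pow_succ]; ring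

/-- Base case: `(16E² + 17) ≤ 2^(4E + 5)`. [folklore] -/
theorem base_le (E : ℕ) : 16 * E ^ 2 + 17 ≤ 2 ^ (4 * E + 5) := by
  have h1 : E ^ 2 ≤ 4 ^ E := sq_le_four_pow E
  have h2 : (2 : ℕ) ^ (4 * E + 5) = 32 * (4 ^ E * 4 ^ E) := by
    rw [pow_add, pow_mul, show (2 : ℕ) ^ 4 = 4 * 4 by norm_num, mul_pow]; ring
  rw [h2]
  rcases Nat.eq_zero_or_pos E with rfl | hE
  · norm_num
  · have h3 : 4 ≤ 4 ^ E := by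
      calc 4 = 4 ^ 1 := by norm_num
        _ ≤ 4 ^ E := Nat.pow_le_pow_right (by norm_num) hE
    nlinarith

/-- `(M+1)^(2E) ≤ 2^M` for all `M ≥ 16E² + 16`. [folklore] -/
theorem succ_pow_le_two_pow (E : ℕ) : ∀ M : ℕ, 16 * E ^ 2 + 16 ≤ M → (M + 1) ^ (2 * E) ≤ 2 ^ M := by
  -- induction on the excess over the threshold
  suffices h : ∀ i : ℕ, (16 * E ^ 2 + 16 + i + 1) ^ (2 * E) ≤ 2 ^ (16 * E ^ 2 + 16 + i) by
    intro M hM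
    obtain ⟨i, rfl⟩ := Nat.exists_eq_add_of_le hM
    exact h i
  intro i
  induction i with
  | zero =>
    -- base: `(16E²+17)^(2E) ≤ (2^(4E+5))^(2E) = 2^((4E+5)·2E) ≤ 2^(16E²+16)`
    rw [Nat.add_zero]
    calc (16 * E ^ 2 + 16 + 1) ^ (2 * E) ≤ (2 ^ (4 * E + 5)) ^ (2 * E) :=
          Nat.pow_le_pow_left (by simpa [add_assoc] using base_le E) _
      _ = 2 ^ ((4 * E + 5) * (2 * E)) := by rw [← pow_mul]
      _ ≤ 2 ^ (16 * E ^ 2 + 16) := Nat.pow_le_pow_right (by norm_num) (by nlinarith)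
  | succ i ih =>
    -- step: `(a+1)^(2E) ≤ 2 a^(2E)` with `a = 16E²+17+i ≥ 2·(2E)`
    have ha : 2 * (2 * E) ≤ 16 * E ^ 2 + 16 + i + 1 := by nlinarith
    calc (16 * E ^ 2 + 16 + (i + 1) + 1) ^ (2 * E) = (16 * E ^ 2 + 16 + i + 1 + 1) ^ (2 * E) := by ring_nf
      _ ≤ 2 * (16 * E ^ 2 + 16 + i + 1) ^ (2 * E) := succ_pow_le_two_mul_pow ha (by omega)
      _ ≤ 2 * 2 ^ (16 * E ^ 2 + 16 + i) := Nat.mul_le_mul_left 2 ih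
      _ = 2 ^ (16 * E ^ 2 + 16 + (i + 1)) := by rw [← add_assoc, pow_succ]; ring

/-- `A ≤ 2^(Nat.log 2 A + 1)`. [folklore] -/
theorem le_two_pow_log_succ (A : ℕ) : A ≤ 2 ^ (Nat.log 2 A + 1) :=
  (Nat.lt_pow_succ_log_self (by norm_num) A).le


namespace Params

/-! Parameter definitions (inputs `u σ K k`). -/

/-- Parameter `Ep` of the explicit parameter choice (see the module docstring). [cite: Khot2005, §7.3] -/
def Ep (k : ℕ) : ℕ := 5 * (k + 1)
/-- Parameter `S₀` of the explicit parameter choice (see the module docstring). [cite: Khot2005, §7.3] -/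
def S₀ (K : ℕ) : ℕ := 32 * K + 1 + 40 * K * (31 * K) ^ 2 + (35 * K) ^ 2
/-- Parameter `D₀` of the explicit parameter choice (see the module docstring). [cite: Khot2005, §7.3] -/
def D₀ (K k : ℕ) : ℕ := S₀ K ^ k * (40 * K) ^ (k + 1)
/-- Parameter `A` of the explicit parameter choice (see the module docstring). [cite: Khot2005, §7.3] -/
def A (u σ K k : ℕ) : ℕ :=
  2 * 10 ^ 8 * K * 2 ^ (20 * K) * (31 * K) ^ (31 * K) * (u + σ + 40 * K + 1) ^ (10 * K) *
    2 ^ (10 * K) * D₀ K k ^ (10 * K)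
/-- Parameter `M'` of the explicit parameter choice (see the module docstring). [cite: Khot2005, §7.3] -/
def M' (u σ K k : ℕ) : ℕ :=
  (Nat.log 2 (A u σ K k) + 1) / (K + 1) + 1 + (16 * Ep k ^ 2 + 16) + (Nat.log 2 (200 * (31 * K) ^ 2) + 1)
/-- Parameter `MM` of the explicit parameter choice (see the module docstring). [cite: Khot2005, §7.3] -/
def MM (u σ K k : ℕ) : ℕ := 2 * M' u σ K k
/-- Parameter `NN` of the explicit parameter choice (see the module docstring). [cite: Khot2005, §7.3] -/
def NN (u σ K k : ℕ) : ℕ := 2 ^ MM u σ K k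
/-- Parameter `hh` of the explicit parameter choice (see the module docstring). [cite: Khot2005, §7.3] -/
def hh (u σ K k : ℕ) : ℕ := 20 * K * (MM u σ K k + 1)
/-- Parameter `ss` of the explicit parameter choice (see the module docstring). [cite: Khot2005, §7.3] -/
def ss (u σ K k : ℕ) : ℕ := K + (31 * K + hh u σ K k * (31 * K) ^ 2) + 1 + (35 * K) ^ 2
/-- Parameter `DD` of the explicit parameter choice (see the module docstring). [cite: Khot2005, §7.3] -/
def DD (u σ K k : ℕ) : ℕ := ss u σ K k ^ k * (40 * K) ^ (k + 1)
/-- Parameter `rows` of the explicit parameter choice (see the module docstring). [cite: Khot2005, §7.3] -/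
def rows (u σ K k : ℕ) : ℕ := u + σ + hh u σ K k + NN u σ K k
/-- Parameter `Abound` of the explicit parameter choice (see the module docstring). [cite: Khot2005, §7.3] -/
def Abound (u σ K k : ℕ) : ℕ :=
  ((40 * K - 1) / 4 + 1) * rows u σ K k ^ ((40 * K - 1) / 4) * (2 * DD u σ K k) ^ ((40 * K - 1) / 4)
/-- Parameter `qq` of the explicit parameter choice (see the module docstring). [cite: Khot2005, §7.3] -/
def qq (u σ K k : ℕ) : ℕ := max 1 (100 * Abound u σ K k * DD u σ K k)
/-- Parameter `B'` of the explicit parameter choice (see the module docstring). [cite: Khot2005, §7.3] -/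
def B' (u σ K k : ℕ) : ℕ := 100 * qq u σ K k * (31 * K) ^ (31 * K)

variable (u σ K k : ℕ)

/-- Auxiliary estimate `M'_ge_div` for the explicit parameter choice (see the module docstring). [folklore] -/
theorem M'_ge_div : (Nat.log 2 (A u σ K k) + 1) / (K + 1) + 1 ≤ M' u σ K k := by
  unfold M'; exact Nat.le_add_right_of_le (Nat.le_add_right _ _)
/-- Auxiliary estimate `M'_ge_Ep` for the explicit parameter choice (see the module docstring). [folklore] -/
theorem M'_ge_Ep : 16 * Ep k ^ 2 + 16 ≤ M' u σ K k := by
  unfold M'; exact Nat.le_add_right_of_le (Nat.le_add_left _ _)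
/-- Auxiliary estimate `M'_ge_log` for the explicit parameter choice (see the module docstring). [folklore] -/
theorem M'_ge_log : Nat.log 2 (200 * (31 * K) ^ 2) + 1 ≤ M' u σ K k := by
  unfold M'; exact Nat.le_add_left _ _

/-- Auxiliary estimate `one_le_ss` for the explicit parameter choice (see the module docstring). [folklore] -/
theorem one_le_ss : 1 ≤ ss u σ K k := by unfold ss; omega

/-- The modulus is never zero (so that `ZMod q` is a finite type). [folklore] -/
instance neZero_qq : NeZero (qq u σ K k) := ⟨Nat.one_le_iff_ne_zero.1 (by unfold qq; exact le_max_left _ _)⟩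
/-- Auxiliary estimate `ss_le` for the explicit parameter choice (see the module docstring). [folklore] -/
theorem ss_le (hK : 1 ≤ K) : ss u σ K k ≤ S₀ K * (M' u σ K k + 1) := by
  unfold ss hh MM S₀
  set M := M' u σ K k
  have h1 : 20 * K * (2 * M + 1) ≤ 40 * K * (M + 1) := by nlinarith
  have h2 : 1 ≤ M + 1 := by omega
  calc K + (31 * K + 20 * K * (2 * M + 1) * (31 * K) ^ 2) + 1 + (35 * K) ^ 2
      ≤ (32 * K + 1) * (M + 1) + 40 * K * (M + 1) * (31 * K) ^ 2 + (35 * K) ^ 2 * (M + 1) := by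
        have a1 : K + 31 * K + 1 ≤ (32 * K + 1) * (M + 1) := by nlinarith
        have a2 : 20 * K * (2 * M + 1) * (31 * K) ^ 2 ≤ 40 * K * (M + 1) * (31 * K) ^ 2 :=
          Nat.mul_le_mul_right _ h1
        have a3 : (35 * K) ^ 2 ≤ (35 * K) ^ 2 * (M + 1) := Nat.le_mul_of_pos_right _ (by omega)
        omega
    _ = (32 * K + 1 + 40 * K * (31 * K) ^ 2 + (35 * K) ^ 2) * (M + 1) := by ring

/-- Auxiliary estimate `DD_le` for the explicit parameter choice (see the module docstring). [folklore] -/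
theorem DD_le (hK : 1 ≤ K) : DD u σ K k ≤ D₀ K k * (M' u σ K k + 1) ^ k := by
  unfold DD D₀
  calc ss u σ K k ^ k * (40 * K) ^ (k + 1) ≤ (S₀ K * (M' u σ K k + 1)) ^ k * (40 * K) ^ (k + 1) :=
        Nat.mul_le_mul_right _ (Nat.pow_le_pow_left (ss_le u σ K k hK) k)
    _ = S₀ K ^ k * (40 * K) ^ (k + 1) * (M' u σ K k + 1) ^ k := by rw [mul_pow]; ring

/-- Auxiliary estimate `one_le_DD` for the explicit parameter choice (see the module docstring). [folklore] -/
theorem one_le_DD (hK : 1 ≤ K) : 1 ≤ DD u σ K k := by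
  unfold DD
  exact Nat.one_le_iff_ne_zero.2 (Nat.mul_ne_zero (pow_ne_zero _ (by have := one_le_ss u σ K k; omega))
    (pow_ne_zero _ (by omega)))

/-- For `K ≥ 1` the modulus is the product `100 · #A_bound · D`. [cite: Khot2005, §5.2.1] -/
theorem qq_eq (hK : 1 ≤ K) : qq u σ K k = 100 * Abound u σ K k * DD u σ K k := by
  unfold qq
  refine max_eq_right (Nat.one_le_iff_ne_zero.2 (Nat.mul_ne_zero (Nat.mul_ne_zero (by norm_num) ?_) ?_))
  · unfold Abound
    refine Nat.mul_ne_zero (Nat.mul_ne_zero (by omega) (pow_ne_zero _ ?_)) (pow_ne_zero _ ?_)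
    · unfold rows NN; have := Nat.one_le_two_pow (n := MM u σ K k); omega
    · have := one_le_DD u σ K k hK; omega
  · have := one_le_DD u σ K k hK; omega

/-- `200·(31K)² < N`. [folklore] -/
theorem lt_NN : 200 * (31 * K) ^ 2 < NN u σ K k := by
  unfold NN MM
  have h1 : 200 * (31 * K) ^ 2 < 2 ^ (Nat.log 2 (200 * (31 * K) ^ 2) + 1) :=
    Nat.lt_pow_succ_log_self (by norm_num) _
  refine h1.trans_le (Nat.pow_le_pow_right (by norm_num) ?_)
  have := M'_ge_log u σ K k
  omega

/-- `(M'+1)^(10(k+1)) ≤ 2^M'`. [folklore] -/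
theorem Msucc_pow_le : (M' u σ K k + 1) ^ (10 * (k + 1)) ≤ 2 ^ M' u σ K k := by
  have h := succ_pow_le_two_pow (Ep k) (M' u σ K k) (M'_ge_Ep u σ K k)
  rwa [show 2 * Ep k = 10 * (k + 1) by unfold Ep; ring] at h

/-- `A ≤ 2^(M'·(K+1))`. [folklore] -/
theorem A_le : A u σ K k ≤ 2 ^ (M' u σ K k * (K + 1)) := by
  refine (le_two_pow_log_succ _).trans (Nat.pow_le_pow_right (by norm_num) ?_)
  have h1 : Nat.log 2 (A u σ K k) + 1 < ((Nat.log 2 (A u σ K k) + 1) / (K + 1) + 1) * (K + 1) := by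
    rw [Nat.add_mul, one_mul]
    exact Nat.lt_div_mul_add (by omega)
  have h2 : ((Nat.log 2 (A u σ K k) + 1) / (K + 1) + 1) * (K + 1) ≤ M' u σ K k * (K + 1) :=
    Nat.mul_le_mul_right _ (M'_ge_div u σ K k)
  omega

/-- Auxiliary estimate `rows_le` for the explicit parameter choice (see the module docstring). [folklore] -/
theorem rows_le (hK : 1 ≤ K) :
    rows u σ K k ≤ NN u σ K k * ((u + σ + 40 * K + 1) * (M' u σ K k + 1)) := by
  unfold rows hh MM
  set M := M' u σ K k
  set N := NN u σ K k
  have hN : 1 ≤ N := Nat.one_le_two_pow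
  have h3 : u + σ + 20 * K * (2 * M + 1) + 1 ≤ (u + σ + 40 * K + 1) * (M + 1) := by nlinarith
  calc u + σ + 20 * K * (2 * M + 1) + N ≤ (u + σ + 20 * K * (2 * M + 1)) * N + N :=
        Nat.add_le_add_right (Nat.le_mul_of_pos_right _ (by omega)) N
    _ = (u + σ + 20 * K * (2 * M + 1) + 1) * N := by ring
    _ ≤ ((u + σ + 40 * K + 1) * (M + 1)) * N := Nat.mul_le_mul_right _ h3
    _ = N * ((u + σ + 40 * K + 1) * (M + 1)) := mul_comm _ _

/-- Auxiliary quantities of the main inequality. [folklore] -/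
def L (K : ℕ) : ℕ := 10 * K - 1
/-- Parameter `R` of the explicit parameter choice (see the module docstring). [cite: Khot2005, §7.3] -/
def R (u σ K k : ℕ) : ℕ := (u + σ + 40 * K + 1) * (M' u σ K k + 1)
/-- Parameter `Pexpr` of the explicit parameter choice (see the module docstring). [cite: Khot2005, §7.3] -/
def Pexpr (u σ K k : ℕ) : ℕ :=
  2 * 10 ^ 7 * K * 2 ^ (20 * K) * (31 * K) ^ (31 * K) * R u σ K k ^ L K * 2 ^ L K * DD u σ K k ^ (L K + 1)

/-- Auxiliary estimate `L_succ` for the explicit parameter choice (see the module docstring). [folklore] -/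
theorem L_succ (hK : 1 ≤ K) : L K + 1 = 10 * K := by unfold L; omega
/-- Auxiliary estimate `div_eq_L` for the explicit parameter choice (see the module docstring). [folklore] -/
theorem div_eq_L (hK : 1 ≤ K) : (40 * K - 1) / 4 = L K := by unfold L; omega
/-- Auxiliary estimate `one_le_R` for the explicit parameter choice (see the module docstring). [folklore] -/
theorem one_le_R : 1 ≤ R u σ K k :=
  Nat.one_le_iff_ne_zero.2 (Nat.mul_ne_zero (by omega) (by omega))
/-- Auxiliary estimate `hh_eq` for the explicit parameter choice (see the module docstring). [folklore] -/
theorem hh_eq : hh u σ K k = 40 * K * M' u σ K k + 20 * K := by unfold hh MM; ring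

/-- Auxiliary estimate `stepA` for the explicit parameter choice (see the module docstring). [folklore] -/
theorem stepA (hK : 1 ≤ K) :
    Abound u σ K k ≤ 10 * K * ((2 ^ (2 * M' u σ K k) * R u σ K k) ^ L K * (2 * DD u σ K k) ^ L K) := by
  unfold Abound
  rw [div_eq_L K hK, L_succ K hK, mul_assoc]
  have hrows : rows u σ K k ≤ 2 ^ (2 * M' u σ K k) * R u σ K k := rows_le u σ K k hK
  exact Nat.mul_le_mul_left _ (Nat.mul_le_mul_right _ (Nat.pow_le_pow_left hrows _))

/-- Auxiliary estimate `stepB` for the explicit parameter choice (see the module docstring). [folklore] -/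
theorem stepB (hK : 1 ≤ K) :
    200 * 2 ^ hh u σ K k * B' u σ K k ≤ 2 ^ (40 * K * M' u σ K k + 2 * M' u σ K k * L K) * Pexpr u σ K k := by
  unfold B' Pexpr
  rw [qq_eq u σ K k hK, hh_eq]
  set M := M' u σ K k
  set D := DD u σ K k
  set Rr := R u σ K k
  calc 200 * 2 ^ (40 * K * M + 20 * K) * (100 * (100 * Abound u σ K k * D) * (31 * K) ^ (31 * K))
      ≤ 200 * 2 ^ (40 * K * M + 20 * K) *
          (100 * (100 * (10 * K * ((2 ^ (2 * M) * Rr) ^ L K * (2 * D) ^ L K)) * D) * (31 * K) ^ (31 * K)) := by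
        gcongr
        exact stepA u σ K k hK
    _ = 2 ^ (40 * K * M + 2 * M * L K) *
        (2 * 10 ^ 7 * K * 2 ^ (20 * K) * (31 * K) ^ (31 * K) * Rr ^ L K * 2 ^ L K * D ^ (L K + 1)) := by
        rw [mul_pow, mul_pow, ← pow_mul, pow_succ]
        ring

/-- Auxiliary estimate `stepC` for the explicit parameter choice (see the module docstring). [folklore] -/
theorem stepC (hK : 1 ≤ K) : Pexpr u σ K k ≤ A u σ K k * (M' u σ K k + 1) ^ (10 * K * (k + 1)) := by
  unfold Pexpr A
  set M := M' u σ K k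
  have hR1 := one_le_R u σ K k
  have hRL : R u σ K k ^ L K ≤ (u + σ + 40 * K + 1) ^ (10 * K) * (M + 1) ^ (10 * K) := by
    rw [← mul_pow, ← L_succ K hK]
    exact Nat.pow_le_pow_right hR1 (Nat.le_succ _)
  have h2L : 2 ^ L K ≤ 2 ^ (10 * K) := Nat.pow_le_pow_right (by norm_num) (by rw [← L_succ K hK]; omega)
  have hDL : DD u σ K k ^ (L K + 1) ≤ D₀ K k ^ (10 * K) * (M + 1) ^ (10 * K * k) := by
    rw [L_succ K hK]
    calc DD u σ K k ^ (10 * K) ≤ (D₀ K k * (M + 1) ^ k) ^ (10 * K) := Nat.pow_le_pow_left (DD_le u σ K k hK) _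
      _ = D₀ K k ^ (10 * K) * (M + 1) ^ (10 * K * k) := by rw [mul_pow, ← pow_mul]; ring_nf
  -- collect
  set X := 2 ^ (20 * K) * (31 * K) ^ (31 * K) with hX
  set Y := (u + σ + 40 * K + 1) ^ (10 * K) with hY
  set Z := D₀ K k ^ (10 * K) with hZ
  calc 2 * 10 ^ 7 * K * 2 ^ (20 * K) * (31 * K) ^ (31 * K) * R u σ K k ^ L K * 2 ^ L K * DD u σ K k ^ (L K + 1)
      = 2 * 10 ^ 7 * K * X * R u σ K k ^ L K * 2 ^ L K * DD u σ K k ^ (L K + 1) := by rw [hX]; ring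
    _ ≤ 2 * 10 ^ 7 * K * X * (Y * (M + 1) ^ (10 * K)) * 2 ^ (10 * K) * (Z * (M + 1) ^ (10 * K * k)) := by
        gcongr
    _ = 2 * 10 ^ 7 * (K * X * Y * 2 ^ (10 * K) * Z * (M + 1) ^ (10 * K * (k + 1))) := by
        rw [show 10 * K * (k + 1) = 10 * K + 10 * K * k by ring, pow_add]; ring
    _ ≤ 2 * 10 ^ 8 * (K * X * Y * 2 ^ (10 * K) * Z * (M + 1) ^ (10 * K * (k + 1))) :=
        Nat.mul_le_mul_right _ (by norm_num)
    _ = 2 * 10 ^ 8 * K * 2 ^ (20 * K) * (31 * K) ^ (31 * K) * (u + σ + 40 * K + 1) ^ (10 * K) *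
          2 ^ (10 * K) * D₀ K k ^ (10 * K) * (M + 1) ^ (10 * K * (k + 1)) := by rw [hX, hY, hZ]; ring

/-- Auxiliary estimate `stepD` for the explicit parameter choice (see the module docstring). [folklore] -/
theorem stepD : A u σ K k * (M' u σ K k + 1) ^ (10 * K * (k + 1)) ≤
    2 ^ (M' u σ K k * (K + 1) + M' u σ K k * K) := by
  have h1 := A_le u σ K k
  have h2 : (M' u σ K k + 1) ^ (10 * K * (k + 1)) ≤ 2 ^ (M' u σ K k * K) := by
    have e1 : (M' u σ K k + 1) ^ (10 * K * (k + 1)) = ((M' u σ K k + 1) ^ (10 * (k + 1))) ^ K := by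
      rw [← pow_mul]; ring_nf
    have e2 : (2 : ℕ) ^ (M' u σ K k * K) = (2 ^ M' u σ K k) ^ K := by rw [← pow_mul]
    rw [e1, e2]
    exact Nat.pow_le_pow_left (Msucc_pow_le u σ K k) K
  rw [pow_add]
  exact Nat.mul_le_mul h1 h2

/-- Auxiliary estimate `stepE` for the explicit parameter choice (see the module docstring). [folklore] -/
theorem stepE (hK : 1 ≤ K) :
    2 ^ (40 * K * M' u σ K k + 2 * M' u σ K k * L K) * 2 ^ (M' u σ K k * (K + 1) + M' u σ K k * K) ≤
      NN u σ K k ^ (31 * K) := by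
  unfold NN MM
  rw [← pow_mul, ← pow_add]
  refine Nat.pow_le_pow_right (by norm_num) ?_
  set M := M' u σ K k
  have hL2 : 2 * L K + 1 ≤ 20 * K := by unfold L; omega
  have : 2 * M * L K + M ≤ 20 * K * M := by nlinarith
  nlinarith

/-- The main sampling inequality, second half: `200 · 2^h · B' ≤ N^(31K)`. [folklore] -/
theorem main_ineq (hK : 1 ≤ K) : 200 * 2 ^ hh u σ K k * B' u σ K k ≤ NN u σ K k ^ (31 * K) :=
  calc 200 * 2 ^ hh u σ K k * B' u σ K k
      ≤ 2 ^ (40 * K * M' u σ K k + 2 * M' u σ K k * L K) * Pexpr u σ K k := stepB u σ K k hK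
    _ ≤ 2 ^ (40 * K * M' u σ K k + 2 * M' u σ K k * L K) * (A u σ K k * (M' u σ K k + 1) ^ (10 * K * (k + 1))) :=
        Nat.mul_le_mul_left _ (stepC u σ K k hK)
    _ ≤ 2 ^ (40 * K * M' u σ K k + 2 * M' u σ K k * L K) * 2 ^ (M' u σ K k * (K + 1) + M' u σ K k * K) :=
        Nat.mul_le_mul_left _ (stepD u σ K k)
    _ ≤ NN u σ K k ^ (31 * K) := stepE u σ K k hK

/-- Full first sampling condition from the two halves. [folklore] -/
theorem hS1_of (hK : 1 ≤ K) {C : ℕ} (hC : C ≤ (31 * K) ^ 2 * NN u σ K k ^ (31 * K - 1)) :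
    100 * (C + 2 ^ hh u σ K k * B' u σ K k) ≤ NN u σ K k ^ (31 * K) := by
  have h1 : 200 * C ≤ NN u σ K k ^ (31 * K) := by
    have hN := lt_NN u σ K k
    calc 200 * C ≤ 200 * ((31 * K) ^ 2 * NN u σ K k ^ (31 * K - 1)) := Nat.mul_le_mul_left _ hC
      _ = (200 * (31 * K) ^ 2) * NN u σ K k ^ (31 * K - 1) := by ring
      _ ≤ NN u σ K k * NN u σ K k ^ (31 * K - 1) := Nat.mul_le_mul_right _ hN.le
      _ = NN u σ K k ^ (31 * K) := by rw [← pow_succ']; congr 1; omega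
  have h2 := main_ineq u σ K k hK
  nlinarith

/-- The threshold numerator `X = 2·W²·g₀^(k+1)` with `W = s^k`, `g₀ = 35K`. [folklore] -/
def XX (u σ K k : ℕ) : ℕ := 2 * (ss u σ K k ^ k) ^ 2 * (35 * K) ^ (k + 1)
/-- `τ = ⌊√X⌋ + 1`. [folklore] -/
def tauN (u σ K k : ℕ) : ℕ := Nat.sqrt (XX u σ K k) + 1

/-- Auxiliary estimate `XX_lt_tau_sq` for the explicit parameter choice (see the module docstring). [folklore] -/
theorem XX_lt_tau_sq : XX u σ K k < tauN u σ K k ^ 2 := by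
  unfold tauN; exact Nat.lt_succ_sqrt' _
/-- Auxiliary estimate `one_le_XX` for the explicit parameter choice (see the module docstring). [folklore] -/
theorem one_le_XX (hK : 1 ≤ K) : 1 ≤ XX u σ K k := by
  unfold XX
  have := one_le_ss u σ K k
  exact Nat.one_le_iff_ne_zero.2 (Nat.mul_ne_zero (Nat.mul_ne_zero (by norm_num) (pow_ne_zero _ (pow_ne_zero _ (by omega)))) (pow_ne_zero _ (by omega)))
/-- Auxiliary estimate `tau_sq_le` for the explicit parameter choice (see the module docstring). [folklore] -/
theorem tau_sq_le (hK : 1 ≤ K) : tauN u σ K k ^ 2 ≤ 4 * XX u σ K k := by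
  unfold tauN
  have h1 : Nat.sqrt (XX u σ K k) ^ 2 ≤ XX u σ K k := Nat.sqrt_le' _
  have h2 : 1 ≤ Nat.sqrt (XX u σ K k) := by
    rw [Nat.le_sqrt]; exact one_le_XX u σ K k hK
  nlinarith

end Params

/-! ### The final theorem -/

section Final

open Params

/-- The row index type of Khot's intermediate lattice for the explicit parameters. [cite: Khot2005, §5.1] -/
abbrev RowsT (u σ K k : ℕ) : Type :=
  (Fin u ⊕ Fin σ) ⊕ ((Fin (20 * K) × Fin (MM u σ K k + 1)) ⊕ Fin (NN u σ K k))

/-- The column index type of the base basis for the explicit parameters. [cite: Khot2005, §5.2.2] -/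
abbrev ColsT (u σ K k : ℕ) : Type :=
  ((Fin σ ⊕ (Fin (NN u σ K k) ⊕ (Fin (20 * K) × Fin (MM u σ K k + 1)))) ⊕ Unit) ⊕ Unit

/-- The number of rows is `Params.rows`. [folklore] -/
theorem card_RowsT (u σ K k : ℕ) : Fintype.card (RowsT u σ K k) = rows u σ K k := by
  simp only [RowsT, Fintype.card_sum, Fintype.card_prod, Fintype.card_fin]
  unfold rows hh
  ring

open Classical in
/-- **Khot 2005, Thm. 1.1 (first assertion), Euclidean norm, mathematical form with explicit
parameters.** For every `γ₀ ≥ 1` there is a number of levels `k` such that for every set system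
`F` on a universe of size `u ≥ 1` with `σ` sets and every `K ≥ 1`, with the explicit parameters of
`Params` (BCH matrix from `exists_bch01Matrix`, equivalences from `KhotCardinality`), over the
uniform space `Ω = (tuples of 31K columns) × (ℤ/q)^{rows}`:
(YES) if `F` has an exact cover by `K` sets, at most a `2/100` fraction of `Ω` yields an instance
outside `GapSVP.yes`; (NO) if no `< 40K` sets cover the universe, at most a `1/100` fraction
yields an instance outside `GapSVP.no γ₀`. [cite: Khot2005, Thm. 1.1 and §7.3] -/
theorem khot_gap_instances (γ₀ : ℝ) (hγ₀ : 1 ≤ γ₀) :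
    ∃ k : ℕ, ∀ (u σ K : ℕ) (hu : 1 ≤ u) (hK : 1 ≤ K) (F : Fin σ → Finset (Fin u)),
      ∃ (P : Matrix (Fin (20 * K) × Fin (MM u σ K k + 1)) (Fin (NN u σ K k)) ℤ) (Nf : ℕ)
        (eR : Out (RowsT u σ K k ⊕ Unit) (ColsT u σ K k) k ≃ Fin Nf)
        (eC : (Coef (ColsT u σ K k) k ⊕ {o // augPad (n := ColsT u σ K k)
          (basePad (S := Fin σ) (H := Fin (20 * K) × Fin (MM u σ K k + 1)) (Nn := Fin (NN u σ K k))
            (⟨0, hu⟩ : Fin u)) k o}) ≃ Fin Nf),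
        ((∃ T₀ : Finset (Fin σ), T₀.card = K ∧ ∀ e : Fin u, (T₀.filter fun j => e ∈ F j).card = 1) →
          100 * #((univ : Finset ((Fin (31 * K) → Fin (NN u σ K k)) × (RowsT u σ K k → ZMod (qq u σ K k)))).filter
              fun ω => khotInstance (DD u σ K k : ℤ) F P (tupleShift P ω.1) (DD u σ K k : ℤ) (qq u σ K k)
                (⟨0, hu⟩ : Fin u) ((ss u σ K k ^ k : ℕ) : ℤ) k (DD u σ K k : ℤ) (tauN u σ K k : ℚ) eR eC ω.2 ∉
                  GapSVP.yes fun _ => γ₀) ≤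
            2 * (Fintype.card (Fin (NN u σ K k)) ^ (31 * K) * qq u σ K k ^ Fintype.card (RowsT u σ K k))) ∧
        ((∀ T₀ : Finset (Fin σ), T₀.card < 40 * K → ∃ e : Fin u, ∀ j ∈ T₀, e ∉ F j) →
          100 * #((univ : Finset ((Fin (31 * K) → Fin (NN u σ K k)) × (RowsT u σ K k → ZMod (qq u σ K k)))).filter
              fun ω => khotInstance (DD u σ K k : ℤ) F P (tupleShift P ω.1) (DD u σ K k : ℤ) (qq u σ K k)
                (⟨0, hu⟩ : Fin u) ((ss u σ K k ^ k : ℕ) : ℤ) k (DD u σ K k : ℤ) (tauN u σ K k : ℚ) eR eC ω.2 ∉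
                  GapSVP.no fun _ => γ₀) ≤
            Fintype.card (Fin (NN u σ K k)) ^ (31 * K) * qq u σ K k ^ Fintype.card (RowsT u σ K k)) := by
  classical
  -- the number of levels from the target factor
  obtain ⟨k, hk⟩ := pow_unbounded_of_one_lt (8 * γ₀ ^ 2) (by norm_num : (1 : ℝ) < 8 / 7)
  refine ⟨k, fun u σ K hu hK F => ?_⟩
  have hrowsne : 0 < Fintype.card (RowsT u σ K k) :=
    Fintype.card_pos_iff.2 ⟨Sum.inl (Sum.inl ⟨0, hu⟩)⟩
  -- the BCH matrix
  obtain ⟨P, hP01, hPdw⟩ := Literature.InformationTheory.Coding.exists_bch01Matrix (20 * K) (MM u σ K k + 1)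
    (NN u σ K k) (by omega) (by unfold NN; rw [pow_succ]; have := Nat.one_le_two_pow (n := MM u σ K k); omega)
  have hDW : DWise P (40 * K) := by
    intro z hz hcard
    exact hPdw z hz (by omega)
  -- the equivalences
  set e₀ : Fin u := ⟨0, hu⟩
  have hbase := card_base_cols_add_card_basePad (S := Fin σ) (H := Fin (20 * K) × Fin (MM u σ K k + 1))
    (Nn := Fin (NN u σ K k)) e₀
  have hlevel := card_coef_add_card_augPad (n := ColsT u σ K k) (basePad (S := Fin σ)
    (H := Fin (20 * K) × Fin (MM u σ K k + 1)) (Nn := Fin (NN u σ K k)) e₀) hbase k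
  set Nf := Fintype.card (Out (RowsT u σ K k ⊕ Unit) (ColsT u σ K k) k)
  let eR : Out (RowsT u σ K k ⊕ Unit) (ColsT u σ K k) k ≃ Fin Nf := Fintype.equivFin _
  let eC : (Coef (ColsT u σ K k) k ⊕ {o // augPad (n := ColsT u σ K k)
      (basePad (S := Fin σ) (H := Fin (20 * K) × Fin (MM u σ K k + 1)) (Nn := Fin (NN u σ K k)) e₀) k o}) ≃
      Fin Nf := Fintype.equivFinOfCardEq (by rw [Fintype.card_sum]; exact hlevel)
  refine ⟨P, Nf, eR, eC, ?_, ?_⟩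
  · -- YES
    rintro ⟨T₀, hTK, hTex⟩
    have hT₀ := cvpBasis_indicator_sub_target (DD u σ K k : ℤ) F T₀ hTex
    have hQ : (1 : ℤ) ≤ (DD u σ K k : ℤ) := by exact_mod_cast one_le_DD u σ K k hK
    have hS1 : 100 * (#((univ : Finset (Fin (31 * K) → Fin (NN u σ K k))).filter fun g => ¬Function.Injective g) +
        2 ^ Fintype.card (Fin (20 * K) × Fin (MM u σ K k + 1)) * B' u σ K k) ≤ Fintype.card (Fin (NN u σ K k)) ^ (31 * K) := by
      rw [Fintype.card_prod, Fintype.card_fin, Fintype.card_fin, Fintype.card_fin,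
        show 20 * K * (MM u σ K k + 1) = hh u σ K k from rfl]
      refine hS1_of u σ K k hK ?_
      have h := card_not_injective_le (α := Fin (NN u σ K k)) (31 * K)
      rw [Fintype.card_fin] at h
      exact h.trans (le_of_eq (by ring))
    have hs1 := one_le_ss u σ K k
    have hsW : (((ss u σ K k : ℕ) : ℤ)) ^ k ≤ (((ss u σ K k ^ k : ℕ) : ℤ)) ^ 2 := by
      rw [Nat.cast_pow, ← pow_mul]
      exact pow_le_pow_right₀ (by exact_mod_cast hs1) (by omega)
    have hle : (((2 * ((ss u σ K k ^ k : ℕ) : ℤ) ^ 2 * (35 * K : ℤ) ^ (k + 1) : ℤ)) : ℝ) ≤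
        ((tauN u σ K k : ℚ) : ℝ) ^ 2 := by
      have h1 := (XX_lt_tau_sq u σ K k).le
      have h2 : ((2 * ((ss u σ K k ^ k : ℕ) : ℤ) ^ 2 * (35 * K : ℤ) ^ (k + 1) : ℤ)) = (XX u σ K k : ℤ) := by
        unfold XX; push_cast; ring
      rw [h2, Rat.cast_natCast]
      exact_mod_cast h1
    have h := card_bad_yes_total_le (q := qq u σ K k) (U := Fin u) (S := Fin σ)
      (H := Fin (20 * K) × Fin (MM u σ K k + 1)) (Nn := Fin (NN u σ K k)) hQ hP01 hT₀
      (rr := 31 * K) (by omega) (B' := B' u σ K k) hS1 (le_of_eq (by unfold B'; rfl))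
      hQ e₀ (W := ((ss u σ K k ^ k : ℕ) : ℤ)) (by exact_mod_cast Nat.one_le_pow _ _ hs1) k
      (g₀ := (35 * K : ℤ)) (s := (ss u σ K k : ℤ)) (by rw [hTK]; push_cast; ring) (by
        have : (1 : ℤ) ≤ K := by exact_mod_cast hK
        linarith)
      (by
        rw [hTK, Fintype.card_prod, Fintype.card_fin, Fintype.card_fin]
        unfold ss hh
        push_cast; ring)
      hsW (T := (DD u σ K k : ℤ)) (by positivity) eR eC (fun _ => γ₀) (τ := (tauN u σ K k : ℚ))
      (by unfold tauN; positivity) hle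
    exact h
  · -- NO
    intro hNO
    have hD1 := one_le_DD u σ K k hK
    have hQ : (1 : ℤ) ≤ (DD u σ K k : ℤ) := by exact_mod_cast hD1
    have hs1 := one_le_ss u σ K k
    -- `100·#A·D ≤ q` for every shift
    have hq : ∀ g : Fin (31 * K) → Fin (NN u σ K k),
        100 * #(annoyingVectors (intBasis (DD u σ K k : ℤ) F P (tupleShift P g)) (40 * K) (DD u σ K k)) *
          DD u σ K k ≤ qq u σ K k := by
      intro g
      have hA := card_annoyingVectors_intBasis_le (Q := (DD u σ K k : ℤ)) (by positivity) F hNO hDW le_rfl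
        hD1 (tupleShift P g) hrowsne
      rw [card_RowsT] at hA
      rw [qq_eq u σ K k hK]
      unfold Abound
      exact Nat.mul_le_mul_right _ (Nat.mul_le_mul_left 100 hA)
    have hDk : (((ss u σ K k ^ k : ℕ) : ℤ)) ^ 2 * ((40 * K : ℕ) : ℤ) ^ (k + 1) ≤ ((DD u σ K k : ℕ) : ℤ) ^ 2 := by
      have e : ((DD u σ K k : ℕ) : ℤ) = ((ss u σ K k ^ k : ℕ) : ℤ) * ((40 * K : ℕ) : ℤ) ^ (k + 1) := by
        unfold DD; push_cast; ring
      rw [e, mul_pow]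
      refine mul_le_mul_of_nonneg_left ?_ (sq_nonneg _)
      have h1 : (1 : ℤ) ≤ ((40 * K : ℕ) : ℤ) ^ (k + 1) := one_le_pow₀ (by exact_mod_cast (show 1 ≤ 40 * K by omega))
      exact le_self_pow₀ h1 two_ne_zero
    have hbT : (((ss u σ K k ^ k : ℕ) : ℤ)) ^ 2 * ((40 * K : ℕ) : ℤ) ^ (k + 1) ≤ ((DD u σ K k : ℤ) + 1) ^ 2 :=
      hDk.trans (by nlinarith)
    have hlt : (γ₀ * ((tauN u σ K k : ℚ) : ℝ)) ^ 2 <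
        (((((ss u σ K k ^ k : ℕ) : ℤ)) ^ 2 * ((40 * K : ℕ) : ℤ) ^ (k + 1) : ℤ) : ℝ) := by
      have h1 : ((tauN u σ K k : ℚ) : ℝ) ^ 2 ≤ 4 * (XX u σ K k : ℝ) := by
        rw [Rat.cast_natCast]; exact_mod_cast tau_sq_le u σ K k hK
      have hk' : 8 * γ₀ ^ 2 < (8 / 7 : ℝ) ^ (k + 1) :=
        hk.trans_le (pow_le_pow_right₀ (by norm_num) (Nat.le_succ k))
      have hXX : (XX u σ K k : ℝ) = 2 * ((ss u σ K k : ℝ) ^ k) ^ 2 * (35 * K) ^ (k + 1) := by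
        unfold XX; push_cast; ring
      have hpos : (0 : ℝ) < ((ss u σ K k : ℝ) ^ k) ^ 2 * (35 * K) ^ (k + 1) := by
        have : (1 : ℝ) ≤ ss u σ K k := by exact_mod_cast hs1
        have : (1 : ℝ) ≤ K := by exact_mod_cast hK
        positivity
      have htarget : (((((ss u σ K k ^ k : ℕ) : ℤ)) ^ 2 * ((40 * K : ℕ) : ℤ) ^ (k + 1) : ℤ) : ℝ) =
          ((ss u σ K k : ℝ) ^ k) ^ 2 * ((8 / 7 : ℝ) ^ (k + 1) * (35 * K) ^ (k + 1)) := by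
        have e : (8 / 7 : ℝ) ^ (k + 1) * (35 * (K : ℝ)) ^ (k + 1) = (40 * (K : ℝ)) ^ (k + 1) := by
          rw [← mul_pow]; congr 1; ring
        rw [e]; push_cast; ring
      rw [htarget]
      calc (γ₀ * ((tauN u σ K k : ℚ) : ℝ)) ^ 2 = γ₀ ^ 2 * ((tauN u σ K k : ℚ) : ℝ) ^ 2 := by ring
        _ ≤ γ₀ ^ 2 * (4 * (XX u σ K k : ℝ)) := mul_le_mul_of_nonneg_left h1 (by positivity)
        _ = 8 * γ₀ ^ 2 * (((ss u σ K k : ℝ) ^ k) ^ 2 * (35 * K) ^ (k + 1)) := by rw [hXX]; ring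
        _ < (8 / 7 : ℝ) ^ (k + 1) * (((ss u σ K k : ℝ) ^ k) ^ 2 * (35 * K) ^ (k + 1)) :=
            mul_lt_mul_of_pos_right hk' hpos
        _ = ((ss u σ K k : ℝ) ^ k) ^ 2 * ((8 / 7 : ℝ) ^ (k + 1) * (35 * K) ^ (k + 1)) := by ring
    have hNf : 0 < Nf := by
      rw [← hlevel, card_coef]
      exact Nat.add_pos_left (pow_pos (Fintype.card_pos_iff.2 ⟨Sum.inr ()⟩) _) _
    have h := card_bad_no_total_le (q := qq u σ K k) (U := Fin u) (S := Fin σ)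
      (H := Fin (20 * K) × Fin (MM u σ K k + 1)) (Nn := Fin (NN u σ K k)) hQ F hP01 (31 * K)
      (d := 40 * K) (D := DD u σ K k) hD1 hq e₀ (W := ((ss u σ K k ^ k : ℕ) : ℤ))
      (by exact_mod_cast Nat.one_le_pow _ _ hs1) k hDk (T := (DD u σ K k : ℤ)) (by positivity) hbT hNf eR eC
      (γ := fun _ => γ₀) (by linarith) (τ := (tauN u σ K k : ℚ)) (by unfold tauN; positivity) hlt
    exact h

end Final

end Literature.Algebra.EuclideanLattices.Khot
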